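import Summits.QuantumFields.BalabanUV.Beta.FP.NestedStepLawTorusCompositeG

/-!
# `BalabanUV.Beta.FP.NestedStepLawTorusCompositeSym` — road «FP» for binder row D1, ROUTE T under RULING R-D1-g52-1 (β1) (journal l.56283) ∕ R-FP-70 (l.56383):
# **#19's GRADED TORUS CALL FOR THE (0.4)-SYMMETRISED COMPOSITE TOWER** — `NestedStepLawTorusCompositeG` §1 at `Q := QSym Lc`, `K ℓ _ := bhKStepSh d Lc (Dsh Lc) ℓ`,
# roots `ctrOff (d+1) Lc` at every storey; the brick inputs `hH₀t ∕ hone ∕ hId ∕ htop` DISCHARGED by leaf-05's chart-(III′) letters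

WHY (R-D1-g52-1 (3)(b): «THE COMPOSITE TOWER IS RE-BASED on an1's (0.4)-SYMMETRISED bricks at the centred root at every level so that its top step IS M‴'s step BY
CONSTRUCTION»).  The pins read leaf-06's `TorusCompositeObjectsG` §3 (`compRowsSym ∕ nestedSliceSym` over `QstepSym Lc M ℓ := perF (fine Lc M) (bhKStepSh d Lc (Dsh Lc) ℓ) ∘
((coarsePt, inr), (·, inl))`), the finest form and the top step's rows are the field block ∕ the slot rows of an1's shifted straight spread `bhKStepSh d Lc (Dsh Lc) ℓ`
periodised, the top step in (B)'s slot presentation `(pμ′, mμ′)`; discharged inside: `H₀ᵀ = H₀` (`RelInvPeriodisedCombTorusLetters.torus_H₀_transpose_comb` at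
`towerTorus Lc M′ (n+1)`), (INV-m)(EFF-m)'s one-step letters (`torus_h1_comb ∕ hId_comb`), the top comb-KKT (`RelInvPeriodisedCombRecord.torus_isUnit_det_kkt_combRows_comb`).
Everything else — (SLICE-m)(COV-m)(T-β-m)(WARD-m) rows, parities, namings — DISPLAYED as in #19 (their sym suppliers are leaf-02's ∕ leaf-06's (β1) items).
[folklore] ONE instantiation BY NAME; no `def`, no `def … : Prop`, nothing cited, 0 sorry.  Nothing of the dictionary ∕ Bałaban's asserted (the presentation is the
row's ruling, quoted not adjudicated).  No existing file touched.

HONEST DEPENDENCY (page 1, mandatory): continuum YM on T⁴ ⇐ BetaPertH ∧ nine spine estimates (0/9 proved); BetaPertH ⇐ (D1) ∧ (D4) ∧ CAP+tail;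
G-an2-4 gates asym, D1 and NE2/3/4.  HONEST FRAMING (cell contract, verbatim): «discharging `BetaPertH` makes Bałaban's UV stability UNCONDITIONAL —
a real constructive-QFT result; it is NOT the continuum limit and NOT the Clay problem.»  ABSOLUTE RULE (cell charter, verbatim): «No internally-minted
statement may enter as a cited fact. Every hypothesis is either kernel-proved in this package or a verbatim quotation of a PUBLISHED theorem with page
reference. The manuscript(s) under audit are NOT citable for their own disputed steps — they are the thing under adjudication; programme-internal
(2001/route/tribunal) claims are never citable.»  0 estimates; 0∕4 row-D1 binders (hW, hR, D1Tel, D1Rep); ROOT M‴ p325680 untouched; NOT (C1), NOT (L2′),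
NOT (T-ID), NOT SDF, NOT D1, NOT BetaPertH, NOT continuum, NOT Clay.  Road «FP» OWNER, b2b-balaban-beta-d1-p3 gen 29, 2026-08-24.  No existing file touched.
-/

noncomputable section

namespace Summit.QuantumFields.BalabanUV.Beta.FP.NestedStepLawTorusCompositeSym

open Matrix
open Literature.MathematicalPhysics.QuantumFieldTheory.Balaban1983to89
open Literature.MathematicalPhysics.QuantumFieldTheory.Balaban1983to89.Beta
open Literature.MathematicalPhysics.QuantumFieldTheory.Balaban1983to89.Beta.Composition (kkt)
open Literature.MathematicalPhysics.QuantumFieldTheory.Balaban1983to89.Beta.CompositionSingular (effForm flucCov minOp minOpL)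
open B5Prop11Plancherel (fine)
open B6Lemma24Torus (pbox mem_pbox)
open AffineAveraging (Site box toSite)
open OneStepResolventKernel (Fib)
open Summit.QuantumFields.BalabanUV.Beta.BorderedHessian (bhKStepAt)
open Summit.QuantumFields.BalabanUV.Beta.D1BFx.LogDetSecondVariation (secondVar)
open Summit.QuantumFields.BalabanUV.Beta.FP.KernelPeriodisationFib (Idx perF perF_apply perZ perZ_apply trF perF_transpose)
open Summit.QuantumFields.BalabanUV.Beta.FP.TorusCombRows (Res)
open Summit.QuantumFields.BalabanUV.Beta.FP.CompositeWardLetters (compWard_b0 compWard_b1 compWard_b2)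
open Summit.QuantumFields.BalabanUV.Beta.FP.RelInvPeriodised (bhKStepAt_translate_invariant)
open Summit.QuantumFields.BalabanUV.Beta.FP.PeriodisedWardOrderZero (bhKStepAt_ff_symm)
open Summit.QuantumFields.BalabanUV.Beta.FP.NestedStepLawTransported (secondVar_nestedFP_eq_zero)
open Summit.QuantumFields.BalabanUV.Beta.FP.NestedStepLawTransportedExpGraded (secondVar_oneShot_nestedStepLaw_expTransported_graded_of_uni)
open Summit.QuantumFields.BalabanUV.Beta.FP.TorusCompositeObjects (towerTorus towerTorus_apply compRows nestedSlice NParam Qstep combF bigP towerGen)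
open Summit.QuantumFields.BalabanUV.Beta.FP.TorusCompositeUnimodular (det_bigP_mul_towerGen_ne_zero)
open Summit.QuantumFields.BalabanUV.Beta.FP.TorusCompositeFP (evalN torus_uP_exp_tower)
open Summit.QuantumFields.BalabanUV.Beta.GAN24.FineReadoutCauchyFrame (toSite_mem_range)
open AffineAveraging (unitVec)
open Summit.QuantumFields.BalabanUV.Beta.FP.TorusEffFormComposite (torus_composite_inv_and_eff)
open Summit.QuantumFields.BalabanUV.Beta.FP.RelInvPeriodisedCoarse (det_kkt_smul_form_ne_zero_iff)
open Summit.QuantumFields.BalabanUV.Beta.FP.RelInvPeriodisedCombRows (torus_isUnit_det_kkt_combRows)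
open Summit.QuantumFields.BalabanUV.Beta.FP.RelInvPeriodisedEffFormCoarse (wVH_pos)
open Literature.Probability.LatticeModels (Torus.proj)
open BalabanStepJetsSucc (wVH)
open Finset
open Summit.QuantumFields.BalabanUV.Beta.FP.TorusCompositeObjectsG (StepRows compRowsG nestedSliceG QstepSym QSym compRowsSym nestedSliceSym compRows_eq_compRowsG nestedSlice_eq_nestedSliceG)
open Summit.QuantumFields.BalabanUV.Beta.FP.TorusEffFormCompositeG (torus_composite_inv_and_eff_G)
open Summit.QuantumFields.BalabanUV.Beta.FP.NestedStepLawTorusComposite (H₀_transpose_of_dvd dvd_towerTorus_succ secondVar_oneShot_nestedStepLaw_torus_composite_graded)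
open Summit.QuantumFields.BalabanUV.Beta.SymShiftedSpread (bhKStepSh)
open Summit.QuantumFields.BalabanUV.Beta.DshAn1 (Dsh)
open Summit.QuantumFields.BalabanUV.Beta.FP.RelInvPeriodisedCombTorusLetters (torus_h1_comb hId_comb torus_H₀_transpose_comb)
open Summit.QuantumFields.BalabanUV.Beta.FP.RelInvPeriodisedEffFormCoarse (hId_order_zero_record)
open Summit.QuantumFields.BalabanUV.Beta.FP.RelInvPeriodisedCombRecord (torus_isUnit_det_kkt_combRows_comb)
open Summit.QuantumFields.BalabanUV.Beta.FP.TorusGaugeCovarianceCoarse (coarsePt coarsePt_coe)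
open Summit.QuantumFields.BalabanUV.Beta.FP.NestedStepLawTorusInstance (coarseSlot_injective coarseSlot_range torus_h1)
open AveragingContoursRooted (ctrOff ctrOff_mem_box)
open ExpKernelCalculus (MKer)
open Summit.QuantumFields.BalabanUV.Beta.FP.NestedStepLawTorusCompositeG (secondVar_oneShot_nestedStepLaw_torus_composite_graded_G)

variable {d : ℕ}

section CompositeSym

variable (M' : Fin (d + 1) → ℕ) [∀ μ, NeZero (M' μ)] (Lc : ℕ) [NeZero Lc] (lev : ℕ → ℕ) (n : ℕ)

set_option synthInstance.maxSize 1024 in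
/-- [folklore] **THE GRADED TORUS CALL OF THE (0.4)-SYMMETRISED COMPOSITE TOWER** (R-D1-g52-1 (β1)): §1 at `Q := QSym Lc`, `K ℓ _ := bhKStepSh d Lc (Dsh Lc) ℓ`,
roots `ctrOff (d+1) Lc` at every storey — pins `compRowsSym ∕ nestedSliceSym` (leaf-06), finest form and top step = the field block ∕ the slot rows of an1's shifted
straight spread periodised; `hH₀t ∕ hone ∕ hId ∕ htop` DISCHARGED by leaf-05's chart-(III′) letters (`torus_H₀_transpose_comb`, `torus_h1_comb`, `hId_comb`,
`torus_isUnit_det_kkt_combRows_comb`); the top step in (B)'s slot presentation `(pμ′, mμ′)`.  Everything else displayed as in #19. -/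
theorem secondVar_oneShot_nestedStepLaw_torus_composite_graded_sym (hlev : ∀ i, lev i = lev (i + 1) + 1)
    (hM' : ∀ i, Lc ∣ M' i)
    -- the coarse multipliers' slot presentation one level above `M′` (as (B): injective, `inr`-valued, exactly the `Lc`-coarse sites of `M′`)
    {κ : Type*} [Fintype κ] [DecidableEq κ] (pμ' : κ → ↥(pbox M')) (mμ' : κ → Fin (d + 1))
    (hfμ' : Function.Injective (fun a : κ => ((pμ' a, Sum.inr (mμ' a)) : Idx M' (Fib d))))
    (hcoarse' : ∀ (s : ↥(pbox M')) (m : Fin (d + 1)),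
      ((s, Sum.inr m) : Idx M' (Fib d)) ∈ Set.range (fun a : κ => ((pμ' a, Sum.inr (mμ' a)) : Idx M' (Fib d))) ↔ Torus.proj Lc (s : Site (d + 1)) = 0)
    -- the (0.4)-SYMMETRISED composite objects PINNED (leaf-06 `TorusCompositeObjectsG` §3: `compRowsSym ∕ nestedSliceSym` over `QstepSym`, roots `ctrOff`)
    {H₀ : Matrix (↥(pbox (towerTorus Lc M' (n + 1))) × Fin (d + 1)) (↥(pbox (towerTorus Lc M' (n + 1))) × Fin (d + 1)) ℝ}
    {Q₁₀ : Matrix (↥(pbox M') × Fin (d + 1)) (↥(pbox (towerTorus Lc M' (n + 1))) × Fin (d + 1)) ℝ}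
    {τ₁ : Matrix (NParam Lc (fine Lc M') (fun _ => ctrOff (d + 1) Lc) n) (↥(pbox (towerTorus Lc M' (n + 1))) × Fin (d + 1)) ℝ}
    (hH₀ : H₀ = (perF (towerTorus Lc M' (n + 1)) (bhKStepSh d Lc (Dsh Lc) (lev (n + 1)))).submatrix
        (fun b : ↥(pbox (towerTorus Lc M' (n + 1))) × Fin (d + 1) => ((b.1, Sum.inl b.2) : Idx (towerTorus Lc M' (n + 1)) (Fib d)))
        (fun b : ↥(pbox (towerTorus Lc M' (n + 1))) × Fin (d + 1) => ((b.1, Sum.inl b.2) : Idx (towerTorus Lc M' (n + 1)) (Fib d))))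
    (hQ₁₀ : Q₁₀ = compRowsSym Lc M' lev (fun _ => ctrOff (d + 1) Lc) (n + 1))
    (hτ₁ : τ₁ = nestedSliceSym Lc (fine Lc M') (fun k => lev (k + 1)) (fun _ => ctrOff (d + 1) Lc) n)
    {τ₂ : Matrix (Res (toSite (ctrOff (d + 1) Lc)) Lc M') (↥(pbox M') × Fin (d + 1)) ℝ} (hτ₂ : τ₂ = combF Lc M' (ctrOff (d + 1) Lc))
    -- the top step's averaging rows (level `lev 0`, root `ctrOff`), PINNED as (B)'s `hQ₂₀`
    {Q₂₀ : Matrix κ (↥(pbox M') × Fin (d + 1)) ℝ}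
    (hQ₂₀ : Q₂₀ = (perF M' (bhKStepSh d Lc (Dsh Lc) (lev 0))).submatrix (fun a : κ => ((pμ' a, Sum.inr (mμ' a)) : Idx M' (Fib d)))
        (fun b : ↥(pbox M') × Fin (d + 1) => ((b.1, Sum.inl b.2) : Idx M' (Fib d))))
    -- the tower's generators and the one-shot big comb: FREE matrices of the tower's types in v1 (pinned to leaf-06's `towerGen ∕ bigP` by the (SLICE-m) ∕
    -- (COV-m) suppliers in v1.1; target shape 36f428fe4d8b64c2)
    (W₀ : Matrix (↥(pbox (towerTorus Lc M' (n + 1))) × Fin (d + 1)) (NParam Lc M' (fun _ => ctrOff (d + 1) Lc) (n + 1)) ℝ)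
    (P : Matrix (NParam Lc M' (fun _ => ctrOff (d + 1) Lc) (n + 1)) (↥(pbox (towerTorus Lc M' (n + 1))) × Fin (d + 1)) ℝ)
    -- the displayed jets: form (finest level), composite averaging, the top step's averaging jets, generators, witnesses, composite covariance images
    (H₁ H₂ : Matrix (↥(pbox (towerTorus Lc M' (n + 1))) × Fin (d + 1)) (↥(pbox (towerTorus Lc M' (n + 1))) × Fin (d + 1)) ℝ)
    (Q₁₁ Q₁₂ : Matrix (↥(pbox M') × Fin (d + 1)) (↥(pbox (towerTorus Lc M' (n + 1))) × Fin (d + 1)) ℝ)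
    (Q₂₁ Q₂₂ : Matrix κ (↥(pbox M') × Fin (d + 1)) ℝ)
    (W₁ W₂ : Matrix (↥(pbox (towerTorus Lc M' (n + 1))) × Fin (d + 1)) (NParam Lc M' (fun _ => ctrOff (d + 1) Lc) (n + 1)) ℝ)
    (Dbar Db₁ Db₂ : Matrix (↥(pbox M') × Fin (d + 1)) (Res (toSite (ctrOff (d + 1) Lc)) Lc M') ℝ)
    (Y₀ Y₁ Y₂ : Matrix κ (NParam Lc M' (fun _ => ctrOff (d + 1) Lc) (n + 1)) ℝ)
    -- the chart transport (exponential currency): generators `X` (finest fields), `X̄` (coarse multipliers); one-shot chart's generator jets; parameter-transport jets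
    (X : Matrix (↥(pbox (towerTorus Lc M' (n + 1))) × Fin (d + 1)) (↥(pbox (towerTorus Lc M' (n + 1))) × Fin (d + 1)) ℝ) (Xbar : Matrix κ κ ℝ)
    (W'₁ W'₂ : Matrix (↥(pbox (towerTorus Lc M' (n + 1))) × Fin (d + 1)) (NParam Lc M' (fun _ => ctrOff (d + 1) Lc) (n + 1)) ℝ)
    (C₁ C₂ : Matrix (NParam Lc M' (fun _ => ctrOff (d + 1) Lc) (n + 1)) (NParam Lc M' (fun _ => ctrOff (d + 1) Lc) (n + 1)) ℝ)
    {𝔔₀ 𝔔₁ 𝔔₂ : Matrix κ (↥(pbox (towerTorus Lc M' (n + 1))) × Fin (d + 1)) ℝ}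
    (h𝔔₀ : Q₂₀ * Q₁₀ = 𝔔₀) (h𝔔₁ : Q₂₁ * Q₁₀ + Q₂₀ * Q₁₁ = 𝔔₁) (h𝔔₂ : Q₂₂ * Q₁₀ + Q₂₁ * Q₁₁ + (Q₂₁ * Q₁₁ + Q₂₀ * Q₁₂) = 𝔔₂)
    -- (T-β-m) GRADED: the one-shot literal's composite jets are the graded `X`-conjugated words, NAMED
    {H'₁ H'₂ : Matrix (↥(pbox (towerTorus Lc M' (n + 1))) × Fin (d + 1)) (↥(pbox (towerTorus Lc M' (n + 1))) × Fin (d + 1)) ℝ}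
    {𝔔'₁ 𝔔'₂ : Matrix κ (↥(pbox (towerTorus Lc M' (n + 1))) × Fin (d + 1)) ℝ}
    (k1 : -(Xᵀ * H₀) + H₁ + H₀ * X = H'₁)
    (k2 : (X * X)ᵀ * H₀ + (-(Xᵀ * H₁) + -(Xᵀ * H₀ * X)) + ((-(Xᵀ * H₁) + -(Xᵀ * H₀ * X)) + (H₂ + H₁ * X + (H₁ * X + H₀ * (X * X)))) = H'₂)
    (q1 : Xbar * 𝔔₀ + 𝔔₁ + 𝔔₀ * X = 𝔔'₁)
    (q2 : Xbar * Xbar * 𝔔₀ + (Xbar * 𝔔₁ + Xbar * 𝔔₀ * X) + ((Xbar * 𝔔₁ + Xbar * 𝔔₀ * X) + (𝔔₂ + 𝔔₁ * X + (𝔔₁ * X + 𝔔₀ * (X * X)))) = 𝔔'₂)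
    (j1 : -X * W₀ + W₁ = W'₁ + W₀ * C₁) (j2 : X * X * W₀ + (2 : ℝ) • (-X * W₁) + W₂ = W'₂ + (2 : ℝ) • (W'₁ * C₁) + W₀ * C₂)
    (uC : secondVar (1 : Matrix (NParam Lc M' (fun _ => ctrOff (d + 1) Lc) (n + 1)) (NParam Lc M' (fun _ => ctrOff (d + 1) Lc) (n + 1)) ℝ) C₁ C₂ = 0)
    -- (INV-m)(EFF-m), `H₀ᵀ = H₀` and the top comb-KKT are DISCHARGED inside by leaf-05's chart-(III′) letters
    {Γ : Matrix (↥(pbox (towerTorus Lc M' (n + 1))) × Fin (d + 1)) (↥(pbox (towerTorus Lc M' (n + 1))) × Fin (d + 1)) ℝ}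
    {I : Matrix (↥(pbox (towerTorus Lc M' (n + 1))) × Fin (d + 1)) ((↥(pbox M') × Fin (d + 1)) ⊕ NParam Lc (fine Lc M') (fun _ => ctrOff (d + 1) Lc) n) ℝ}
    {L : Matrix ((↥(pbox M') × Fin (d + 1)) ⊕ NParam Lc (fine Lc M') (fun _ => ctrOff (d + 1) Lc) n) (↥(pbox (towerTorus Lc M' (n + 1))) × Fin (d + 1)) ℝ}
    {S : Matrix ((↥(pbox M') × Fin (d + 1)) ⊕ NParam Lc (fine Lc M') (fun _ => ctrOff (d + 1) Lc) n)
      ((↥(pbox M') × Fin (d + 1)) ⊕ NParam Lc (fine Lc M') (fun _ => ctrOff (d + 1) Lc) n) ℝ}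
    {B : Matrix ((↥(pbox M') × Fin (d + 1)) ⊕ NParam Lc (fine Lc M') (fun _ => ctrOff (d + 1) Lc) n) (↥(pbox (towerTorus Lc M' (n + 1))) × Fin (d + 1)) ℝ}
    (hΓ : flucCov H₀ (fromRows Q₁₀ τ₁) = Γ) (hI : minOp H₀ (fromRows Q₁₀ τ₁) = I) (hL : minOpL H₀ (fromRows Q₁₀ τ₁) = L) (hS : effForm H₀ (fromRows Q₁₀ τ₁) = S)
    (hB : fromRows Q₁₁ (0 : Matrix (NParam Lc (fine Lc M') (fun _ => ctrOff (d + 1) Lc) n) (↥(pbox (towerTorus Lc M' (n + 1))) × Fin (d + 1)) ℝ) = B)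
    -- (SLICE-m) the two Faddeev–Popov pairings are non-degenerate; the one-shot chart's (UNI)-jet letter; the nested chart's dead rows
    (hPW : (P * W₀).det ≠ 0) (hTW : (fromRows (τ₂ * Q₁₀) τ₁ * W₀).det ≠ 0)
    (uP' : secondVar (P * W₀) (P * W'₁) (P * W'₂) = 0) (s1 : τ₁ * W₁ = 0) (s2 : τ₁ * W₂ = 0)
    (t1 : τ₂ * (Q₁₁ * W₀ + Q₁₀ * W₁) = 0) (t2 : τ₂ * (Q₁₂ * W₀ + (2 : ℝ) • (Q₁₁ * W₁) + Q₁₀ * W₂) = 0)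
    -- parities of the displayed form jets; the GRADED Ward rows of the finest form against the composite witnesses (NO transposed rows)
    (hH₁t : H₁ᵀ = -H₁) (hH₂t : H₂ᵀ = H₂)
    (a0 : H₀ * W₀ = 𝔔₀ᵀ * Y₀) (a1 : H₁ * W₀ + H₀ * W₁ = -(𝔔₁ᵀ * Y₀) + 𝔔₀ᵀ * Y₁)
    (a2 : H₂ * W₀ + (2 : ℝ) • (H₁ * W₁) + H₀ * W₂ = 𝔔₂ᵀ * Y₀ + -((2 : ℝ) • (𝔔₁ᵀ * Y₁)) + 𝔔₀ᵀ * Y₂)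
    -- (COV-m) the composite covariance rows (orders 0, 1, 2) and the top step's coarse covariance rows
    (c0 : Q₁₀ * W₀ = fromCols Dbar (0 : Matrix (↥(pbox M') × Fin (d + 1)) (NParam Lc (fine Lc M') (fun _ => ctrOff (d + 1) Lc) n) ℝ))
    (c1 : Q₁₁ * W₀ + Q₁₀ * W₁ = fromCols Db₁ (0 : Matrix (↥(pbox M') × Fin (d + 1)) (NParam Lc (fine Lc M') (fun _ => ctrOff (d + 1) Lc) n) ℝ))
    (c2 : Q₁₂ * W₀ + (2 : ℝ) • (Q₁₁ * W₁) + Q₁₀ * W₂ = fromCols Db₂ (0 : Matrix (↥(pbox M') × Fin (d + 1)) (NParam Lc (fine Lc M') (fun _ => ctrOff (d + 1) Lc) n) ℝ))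
    (d0 : Q₂₀ * Dbar = 0) (d1 : Q₂₁ * Dbar + Q₂₀ * Db₁ = 0) (d2 : Q₂₂ * Dbar + (2 : ℝ) • (Q₂₁ * Db₁) + Q₂₀ * Db₂ = 0) :
    secondVar (kkt H₀ (fromRows 𝔔₀ P))
        (fromBlocks H'₁ (-(fromRows 𝔔'₁ (0 : Matrix (NParam Lc M' (fun _ => ctrOff (d + 1) Lc) (n + 1)) (↥(pbox (towerTorus Lc M' (n + 1))) × Fin (d + 1)) ℝ))ᵀ)
          (fromRows 𝔔'₁ (0 : Matrix (NParam Lc M' (fun _ => ctrOff (d + 1) Lc) (n + 1)) (↥(pbox (towerTorus Lc M' (n + 1))) × Fin (d + 1)) ℝ)) 0)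
        (kkt H'₂ (fromRows 𝔔'₂ (0 : Matrix (NParam Lc M' (fun _ => ctrOff (d + 1) Lc) (n + 1)) (↥(pbox (towerTorus Lc M' (n + 1))) × Fin (d + 1)) ℝ)))
      = secondVar (kkt H₀ (fromRows Q₁₀ τ₁)) (fromBlocks H₁ (-Bᵀ) B 0)
            (kkt H₂ (fromRows Q₁₂ (0 : Matrix (NParam Lc (fine Lc M') (fun _ => ctrOff (d + 1) Lc) n) (↥(pbox (towerTorus Lc M' (n + 1))) × Fin (d + 1)) ℝ)))
        + secondVar
            (kkt S.toBlocks₁₁ (fromRows Q₂₀ τ₂))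
            (fromBlocks ((L * H₁ - S * B) * I + L * Bᵀ * S).toBlocks₁₁ (-(fromRows Q₂₁ (0 : Matrix (Res (toSite (ctrOff (d + 1) Lc)) Lc M') (↥(pbox M') × Fin (d + 1)) ℝ))ᵀ)
              (fromRows Q₂₁ (0 : Matrix (Res (toSite (ctrOff (d + 1) Lc)) Lc M') (↥(pbox M') × Fin (d + 1)) ℝ)) 0)
            (kkt (((-((L * H₁ - S * B) * Γ - L * Bᵀ * L) * H₁ + L * H₂
                      - (((L * H₁ - S * B) * I + L * Bᵀ * S) * B
                          + S * fromRows Q₁₂ (0 : Matrix (NParam Lc (fine Lc M') (fun _ => ctrOff (d + 1) Lc) n) (↥(pbox (towerTorus Lc M' (n + 1))) × Fin (d + 1)) ℝ))) * I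
                    + (L * H₁ - S * B) * (-((Γ * H₁ + I * B) * I + Γ * Bᵀ * S)))
                  - ((-((L * H₁ - S * B) * Γ - L * Bᵀ * L) * (-Bᵀ)
                        + L * (fromRows Q₁₂ (0 : Matrix (NParam Lc (fine Lc M') (fun _ => ctrOff (d + 1) Lc) n) (↥(pbox (towerTorus Lc M' (n + 1))) × Fin (d + 1)) ℝ))ᵀ) * S
                      + L * (-Bᵀ) * ((L * H₁ - S * B) * I + L * Bᵀ * S))).toBlocks₁₁
              (fromRows Q₂₂ (0 : Matrix (Res (toSite (ctrOff (d + 1) Lc)) Lc M') (↥(pbox M') × Fin (d + 1)) ℝ))) := by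
  exact secondVar_oneShot_nestedStepLaw_torus_composite_graded_G M' Lc lev (fun _ => ctrOff (d + 1) Lc) n (QSym Lc)
    (fun ℓ _ => bhKStepSh d Lc (Dsh Lc) ℓ) hlev (hH₀ := hH₀) (hQ₁₀ := hQ₁₀) (hτ₁ := hτ₁)
    (hH₀t := by
      rw [hH₀]
      exact torus_H₀_transpose_comb (towerTorus Lc M' (n + 1)) (dvd_towerTorus_succ (Lc := Lc) M' n) (lev (n + 1)))
    (hone := fun k T _ => torus_h1_comb T (lev k))
    (hId := fun k T _ _ => hId_comb T (lev k))
    (τ₂ := τ₂) (Q₂₀ := Q₂₀)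
    (htop := by
      rw [hQ₂₀, hτ₂]
      exact (torus_isUnit_det_kkt_combRows_comb M' hM' (lev 0) _ hfμ' (fun a => ⟨mμ' a, rfl⟩) hcoarse').ne_zero)
    (W₀ := W₀)
    (P := P)
    (H₁ := H₁)
    (H₂ := H₂)
    (Q₁₁ := Q₁₁)
    (Q₁₂ := Q₁₂)
    (Q₂₁ := Q₂₁)
    (Q₂₂ := Q₂₂)
    (W₁ := W₁)
    (W₂ := W₂)
    (Dbar := Dbar)
    (Db₁ := Db₁)
    (Db₂ := Db₂)
    (Y₀ := Y₀)
    (Y₁ := Y₁)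
    (Y₂ := Y₂)
    (X := X)
    (Xbar := Xbar)
    (W'₁ := W'₁)
    (W'₂ := W'₂)
    (C₁ := C₁)
    (C₂ := C₂)
    (h𝔔₀ := h𝔔₀)
    (h𝔔₁ := h𝔔₁)
    (h𝔔₂ := h𝔔₂)
    (k1 := k1)
    (k2 := k2)
    (q1 := q1)
    (q2 := q2)
    (j1 := j1)
    (j2 := j2)
    (uC := uC)
    (hΓ := hΓ)
    (hI := hI)
    (hL := hL)
    (hS := hS)
    (hB := hB)
    (hPW := hPW)
    (hTW := hTW)
    (uP' := uP')
    (s1 := s1)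
    (s2 := s2)
    (t1 := t1)
    (t2 := t2)
    (hH₁t := hH₁t)
    (hH₂t := hH₂t)
    (a0 := a0)
    (a1 := a1)
    (a2 := a2)
    (c0 := c0)
    (c1 := c1)
    (c2 := c2)
    (d0 := d0)
    (d1 := d1)
    (d2 := d2)

end CompositeSym

end Summit.QuantumFields.BalabanUV.Beta.FP.NestedStepLawTorusCompositeSym

end
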